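import Mathlib
import HarnessLib
import Summits.Ventures.LatticeQCDFlow.Exactness.VMFCosineMarginal

/-!
# The CP(N−1) site heat bath: Wood's cosine and a uniform perpendicular direction assemble to the vMF law exactly

HONEST FRAMING: exact (Metropolis-corrected) sampling algorithms for lattice gauge theory;
figures of merit are autocorrelation/cost numbers at stated couplings and volumes; no
continuum-physics claim.

Venture `LatticeQCDFlow` (cell pub-lqcd), topic `Exactness`, FANOUT row 9 (eng-latcore, the
engine `latflow.core`).  NEW WORK of the cell over row 7's `SphereAxisDisintegration.lean`
(`toSphere_eq_map_latitudePt`: `σ_{S^{n+1}} = latitudePt_*(sinⁿθ dθ|_{[0,π]} ⊗ σ_{Sⁿ})`) and row 9's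
`WoodSampler.lean` / `VMFCosineMarginal.lean`.  Nothing is cited as a fact.  Printed
counterparts, NAMED ONLY: Wood 1994; Mardia–Jupp §9.3.

`cpn_2d.py` `heatbath_sites` (C `cpn_kernel.c` mode 0) draws `w = m·x` by Wood's loop and an
independent direction `v` uniform on the unit sphere orthogonal to `m`, and sets
`z = w m + √(1 − w²) v`.  With `m = e₀` this is row 7's latitude map at `θ = arccos w`:
`latitudePt n (arccos w) v = cos(arccos w) e₀ + sin(arccos w) (0, v)`.  In idealised arithmetic,
given the Beta primitive of Wood's loop:

* `vmfSphere_eq_map_latitudePt` — `vmfSphere κ n = latitudePt_* ((e^{κ cos θ} sinⁿθ dθ|_{[0,π]}) ⊗ σ_{Sⁿ})`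
  (row 7's disintegration, tilted);
* `tiltedPolarLaw_eq_map_arccos` — the tilted polar law is the image of `vmfCosLaw κ (n+1)` under
  `arccos` (`arccos ∘ cos = id` on `[0, π]`, `cos_* polarLaw = (1−c²)^{(n−1)/2}dc`);
* **`map_siteHeatBath_eq_vmfSphere`** — THE SITE HEAT BATH IS EXACT: for `κ ≥ 0`, `n ≥ 1`,
  `((loopLaw (woodRound κ (n+1))) ⊗ uniformSphere_{Sⁿ}).map (fun (w, v) => latitudePt n (arccos w) v)
   = (vmfSphere κ n ℝ)⁻¹ • vmfSphere κ n` — the normalised von Mises–Fisher law on `S^{n+1}`.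

NOT CLAIMED: mean directions `m ≠ e₀` (one rotation away), how the engine draws `v` (a complex
Gaussian projected orthogonally to `m` and normalised — Muller's method, typed for real
coordinates in `StdGaussianRadial.lean`), the Beta/Gamma generators, floating point.
-/

namespace Summit.Ventures.LatticeQCDFlow.Exactness

open MeasureTheory Measure Metric Set Real InnerProductGeometry
open scoped ENNReal RealInnerProductSpace

section Site

variable (n : ℕ)

/-- The tilted polar law `e^{κ cos θ} sinⁿθ dθ|_{[0,π]}`. -/
noncomputable def tiltedPolarLaw (κ : ℝ) (n : ℕ) : Measure ℝ :=
  (polarLaw n).withDensity fun θ => ENNReal.ofReal (Real.exp (κ * Real.cos θ))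

/-- The tilted polar law is s-finite (a density over a restriction of Lebesgue measure). -/
instance sFinite_tiltedPolarLaw (κ : ℝ) : SFinite (tiltedPolarLaw κ n) := by
  unfold tiltedPolarLaw polarLaw; infer_instance

/-- **vMF through the latitude map**: `vmfSphere κ n = latitudePt_* (tiltedPolarLaw κ n ⊗ σ_{Sⁿ})`. -/
theorem vmfSphere_eq_map_latitudePt (κ : ℝ) :
    vmfSphere κ n = ((tiltedPolarLaw κ n).prod
      ((volume : Measure (EuclideanSpace ℝ (Fin (n + 1)))).toSphere)).map
        (fun p : ℝ × sphere (0 : EuclideanSpace ℝ (Fin (n + 1))) 1 => latitudePt n p.1 p.2) := by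
  have hW : Measurable fun w : ℝ => ENNReal.ofReal (Real.exp (κ * w)) := by fun_prop
  haveI : SFinite (polarLaw n) := by unfold polarLaw; infer_instance
  rw [vmfSphere, toSphere_eq_map_latitudePt n,
    ← map_withDensity_comp _ (measurable_latitudePt n)
      (W := fun x : sphere (0 : EuclideanSpace ℝ (Fin (n + 2))) 1 =>
        ENNReal.ofReal (Real.exp (κ * (x : EuclideanSpace ℝ (Fin (n + 2))) 0)))
      (hW.comp (measurable_cosCoord n)),
    tiltedPolarLaw, prod_withDensity_left (f := fun θ : ℝ => ENNReal.ofReal (Real.exp (κ * Real.cos θ)))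
      (hW.comp Real.measurable_cos)]
  congr 1
  refine withDensity_congr_ae (ae_of_all _ fun p => ?_)
  show ENNReal.ofReal (Real.exp (κ * (latitudePt n p.1 p.2 : EuclideanSpace ℝ (Fin (n + 2))) 0)) =
    ENNReal.ofReal (Real.exp (κ * Real.cos p.1))
  rw [← inner_polarAxis n, inner_polarAxis_latitudePt]

/-- **The tilted polar law is the image of `vmfCosLaw κ (n+1)` under `arccos`** (`n ≥ 1`). -/
theorem tiltedPolarLaw_eq_map_arccos {n : ℕ} (hn : 1 ≤ n) (κ : ℝ) :
    tiltedPolarLaw κ n = (vmfCosLaw κ (n + 1)).map Real.arccos := by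
  have hW : Measurable fun w : ℝ => ENNReal.ofReal (Real.exp (κ * w)) := by fun_prop
  haveI : SFinite (polarLaw n) := by unfold polarLaw; infer_instance
  -- `arccos ∘ cos = id` a.e. for the (tilted) polar law, which lives on `[0, π]`
  have hae : (fun θ : ℝ => Real.arccos (Real.cos θ)) =ᵐ[tiltedPolarLaw κ n] id := by
    rw [tiltedPolarLaw, polarLaw]
    refine withDensity_absolutelyContinuous _ _ |>.ae_eq ?_
    refine withDensity_absolutelyContinuous _ _ |>.ae_eq ?_
    filter_upwards [ae_restrict_mem measurableSet_Icc] with θ hθ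
    exact Real.arccos_cos hθ.1 hθ.2
  -- `cos_* (tilted polar law) = vmfCosLaw κ (n+1)`
  have hcos : (tiltedPolarLaw κ n).map Real.cos = vmfCosLaw κ (n + 1) := by
    refine Measure.ext_of_lintegral _ fun h hh => ?_
    rw [lintegral_map hh Real.measurable_cos, tiltedPolarLaw,
      lintegral_withDensity_eq_lintegral_mul _ (f := fun θ : ℝ => ENNReal.ofReal (Real.exp (κ * Real.cos θ)))
        (g := fun θ => h (Real.cos θ)) (hW.comp Real.measurable_cos) (hh.comp Real.measurable_cos),
      show ((fun θ : ℝ => ENNReal.ofReal (Real.exp (κ * Real.cos θ))) * fun θ => h (Real.cos θ)) =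
        fun θ => ((fun w : ℝ => ENNReal.ofReal (Real.exp (κ * w))) * h) (Real.cos θ) from rfl,
      lintegral_cos_polarLaw hn (hW.mul hh), vmfCosLaw, lintegral_withDensity_eq_lintegral_mul _ (by fun_prop) hh]
    refine setLIntegral_congr_fun measurableSet_Ioo fun c hc => ?_
    rw [Pi.mul_apply, Pi.mul_apply, ← mul_assoc, ← ENNReal.ofReal_mul (Real.rpow_nonneg (by nlinarith [hc.1, hc.2]) _),
      show ((n : ℝ) + 1) / 2 - 1 = ((n : ℝ) - 1) / 2 by ring]
  calc tiltedPolarLaw κ n = (tiltedPolarLaw κ n).map id := Measure.map_id.symm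
    _ = (tiltedPolarLaw κ n).map (fun θ => Real.arccos (Real.cos θ)) := (Measure.map_congr hae).symm
    _ = ((tiltedPolarLaw κ n).map Real.cos).map Real.arccos := by
        rw [Measure.map_map Real.measurable_arccos Real.measurable_cos]; rfl
    _ = (vmfCosLaw κ (n + 1)).map Real.arccos := by rw [hcos]

/-- **THE CP(N−1) SITE HEAT BATH IS EXACT** (`κ ≥ 0`, `n ≥ 1`; given the Beta primitive of Wood's
loop): Wood's cosine `w`, an independent direction `v` uniform on `Sⁿ`, and the assembly
`z = w e₀ + √(1−w²)(0, v) = latitudePt n (arccos w) v` produce EXACTLY the normalised von Mises–Fisher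
law `(vmfSphere κ n ℝ)⁻¹ • vmfSphere κ n` on `S^{n+1}`. -/
theorem map_siteHeatBath_eq_vmfSphere {κ : ℝ} (hκ : 0 ≤ κ) {n : ℕ} (hn : 1 ≤ n) :
    ((loopLaw (woodRound κ (n + 1))).prod
        (uniformSphere (volume : Measure (EuclideanSpace ℝ (Fin (n + 1)))))).map
      (fun p : ℝ × sphere (0 : EuclideanSpace ℝ (Fin (n + 1))) 1 => latitudePt n (Real.arccos p.1) p.2) =
      ((vmfSphere κ n) univ)⁻¹ • vmfSphere κ n := by
  have hC0 : ((volume : Measure (EuclideanSpace ℝ (Fin (n + 1)))).toSphere univ) ≠ 0 := toSphere_univ_ne_zero _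
  have hCt : ((volume : Measure (EuclideanSpace ℝ (Fin (n + 1)))).toSphere univ) ≠ ∞ := measure_ne_top _ _
  have huniv : (vmfSphere κ n) univ =
      ((volume : Measure (EuclideanSpace ℝ (Fin (n + 1)))).toSphere univ) * vmfCosLaw κ (n + 1) univ := by
    have h := congrArg (fun μ : Measure ℝ => μ univ) (vmfSphere_map_cosCoord hn κ)
    simp only [Measure.map_apply (measurable_cosCoord n) MeasurableSet.univ, preimage_univ, Measure.smul_apply,
      smul_eq_mul] at h
    exact h
  have hL : Measurable fun p : ℝ × sphere (0 : EuclideanSpace ℝ (Fin (n + 1))) 1 => latitudePt n p.1 p.2 :=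
    measurable_latitudePt n
  haveI : SFinite (vmfCosLaw κ (n + 1)) := by unfold vmfCosLaw; infer_instance
  rw [loopLaw_woodRound hκ (by positivity), Measure.prod_smul_left, Measure.map_smul,
    show (fun p : ℝ × sphere (0 : EuclideanSpace ℝ (Fin (n + 1))) 1 => latitudePt n (Real.arccos p.1) p.2) =
      (fun p : ℝ × sphere (0 : EuclideanSpace ℝ (Fin (n + 1))) 1 => latitudePt n p.1 p.2) ∘
        Prod.map Real.arccos id from rfl,
    ← Measure.map_map hL (Real.measurable_arccos.prodMap measurable_id),
    ← Measure.map_prod_map _ _ Real.measurable_arccos measurable_id, Measure.map_id,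
    ← tiltedPolarLaw_eq_map_arccos hn, uniformSphere, Measure.prod_smul_right, Measure.map_smul,
    ← vmfSphere_eq_map_latitudePt, huniv, smul_smul, ENNReal.mul_inv (Or.inl hC0) (Or.inl hCt), mul_comm _⁻¹]

end Site

end Summit.Ventures.LatticeQCDFlow.Exactness
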